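import Summits.Ventures.PercRepro.RankLevelSetUpNullityFive

/-! # RankLevelSetUpFiveTargets — THE TARGETS OF THE COLOOP RESIDUE (P) (night-1 g41; dossier §53; on
`RankLevelSetUpNullityFive`)

The residue (P) = `UpFiveDeletionResidue M b` (the one named statement left under (↑)₅ on nullity `5`, p741812) is
attacked in the DUAL `N = M✶` (rank `5`, loopless, coloop-free, no parallel triple, `n ≥ 12`): a BAD member is a
base `W ∋ b` of `N` with co-spanning complement whose complement `E ∖ W` has three coloops `C`, so that
`E ∖ W = C ⊔ L'` with `L'` of rank `2` and `≥ n − 8 ≥ 4` elements (a LONG LINE of `N`). The charging of §53 sends a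
bad member to the pairs `(Z, t)` with `Z ∈ V_6(b)` and `t ≠ b` a coloop of `N|(E ∖ Z)`: TYPE B (`b` off the line)
`Z = (W ∖ b) ∪ {ℓ, c}` with `ℓ ∈ L'`, `c ∈ C`, `t ∈ C ∖ c`; TYPE A (`b` on the line) `Z = (W ∖ b) ∪ {ℓ, ℓ'}` with
`{ℓ, ℓ'} ⊆ L'`, `t ∈ C`. This module proves that the targets are VALID: **`typeB_target_valid`** — `Z` spans as
soon as `{ℓ, c} ⊄ cl (W ∖ b)`, `E ∖ Z` spans as soon as `L' ∪ (C ∖ c) ∪ {b}` spans (the validity of `c`), and every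
`t ∈ C ∖ c` is a coloop of `N|(E ∖ Z)` (unconditionally: `(E ∖ Z) ∖ t` sits inside `L' ∪ {c''} ∪ {b}` of rank
`≤ 4`); the type-A target (`b` on the line) is `typeA_target_valid` of the sibling module
`RankLevelSetUpFiveTargetsA`. The two rank-`2` facts behind them: a set of `≥ 3` nonloops without a
parallel triple has rank `≥ 2` (**`two_le_eRk_of_two_lt_ncard`**), so every point of a rank-`≤ 2` set with `≥ 4`
elements is in the closure of the others (**`mem_closure_sdiff_of_eRk_le_two`**) and two points of such a set are in
the closure of the rest as soon as `≥ 5` elements are present (**`pair_subset_closure_sdiff_of_eRk_le_two`**).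
Every declaration has a docstring; imports: the cell's own modules and Mathlib only. Axioms: standard. -/

namespace PercRepro

open Set Matroid

variable {α : Type}

/-! ## Rank-2 sets in a matroid without a parallel triple -/

/-- **A set of more than two nonloops, no three of which are pairwise parallel, has rank at least `2`**: a set of
rank `1` lies in the closure of one of its nonloops, so any three of its elements are pairwise parallel. -/
lemma two_le_eRk_of_two_lt_ncard {N : Matroid α} [N.Finite] {X : Set α} (hXE : X ⊆ N.E)
    (hnl : ∀ e ∈ X, N.IsNonloop e)
    (hnt : ∀ p ∈ X, ∀ q ∈ X, ∀ r ∈ X, p ≠ q → p ≠ r → q ≠ r → q ∈ N.closure {p} → r ∉ N.closure {p})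
    (hX : 2 < X.ncard) : 2 ≤ N.eRk X := by
  classical
  have hXfin : X.Finite := N.ground_finite.subset hXE
  by_contra hlt
  have hlt2 : N.eRk X < 2 := not_le.mp hlt
  rw [← one_add_one_eq_two] at hlt2
  have hle1 : N.eRk X ≤ 1 := Order.le_of_lt_add_one hlt2
  obtain ⟨u, hu⟩ : X.Nonempty := by
    rw [← Set.ncard_pos hXfin]; omega
  have h1 : (1 : ℕ∞) ≤ N.eRk X := by
    rw [← (hnl u hu).eRk_eq]
    exact N.eRk_mono (Set.singleton_subset_iff.mpr hu)
  have heq : N.eRk X = 1 := le_antisymm hle1 h1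
  obtain ⟨e, heX, -, hsub⟩ := (Matroid.eRk_eq_one_iff hXE).mp heq
  have hrest : 1 < (X \ {e}).ncard := by
    rw [Set.ncard_sdiff_singleton_of_mem heX]; omega
  obtain ⟨q, r, hq, hr, hqr⟩ := (Set.one_lt_ncard_iff (hXfin.subset Set.sdiff_subset)).mp hrest
  have hqe : q ≠ e := by simpa using hq.2
  have hre : r ≠ e := by simpa using hr.2
  exact hnt e heX q hq.1 r hr.1 hqe.symm hre.symm hqr (hsub hq.1) (hsub hr.1)

/-- **Every point of a rank-`≤ 2` set with at least four elements (nonloops, no parallel triple) lies in the closure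
of the other points**: the others have `≥ 3` elements, hence rank `≥ 2`, and adding the point cannot raise the rank
to `3`. -/
lemma mem_closure_sdiff_of_eRk_le_two {N : Matroid α} [N.Finite] {L' : Set α} (hLE : L' ⊆ N.E)
    (hnl : ∀ e ∈ L', N.IsNonloop e)
    (hnt : ∀ p ∈ L', ∀ q ∈ L', ∀ r ∈ L', p ≠ q → p ≠ r → q ≠ r → q ∈ N.closure {p} → r ∉ N.closure {p})
    (hL2 : N.eRk L' ≤ 2) (hL4 : 4 ≤ L'.ncard) {ℓ : α} (hℓ : ℓ ∈ L') : ℓ ∈ N.closure (L' \ {ℓ}) := by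
  by_contra hcon
  have h2 : 2 ≤ N.eRk (L' \ {ℓ}) := by
    refine two_le_eRk_of_two_lt_ncard (Set.sdiff_subset.trans hLE) (fun e he => hnl e he.1)
      (fun p hp q hq r hr => hnt p hp.1 q hq.1 r hr.1) ?_
    rw [Set.ncard_sdiff_singleton_of_mem hℓ]; omega
  have hins : N.eRk (insert ℓ (L' \ {ℓ})) = N.eRk (L' \ {ℓ}) + 1 :=
    Matroid.eRk_insert_eq_add_one ⟨hLE hℓ, hcon⟩
  rw [Set.insert_sdiff_singleton, Set.insert_eq_of_mem hℓ] at hins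
  have h3 : (3 : ℕ∞) ≤ N.eRk L' := by
    rw [hins]
    calc (3 : ℕ∞) = 2 + 1 := by norm_num
      _ ≤ N.eRk (L' \ {ℓ}) + 1 := by gcongr
  have h32 : (3 : ℕ∞) ≤ 2 := h3.trans hL2
  have h32' : (3 : ℕ) ≤ 2 := by exact_mod_cast h32
  omega

/-- **Two points of a rank-`≤ 2` set with at least five elements (nonloops, no parallel triple) lie in the closure
of the other points.** -/
lemma pair_subset_closure_sdiff_of_eRk_le_two {N : Matroid α} [N.Finite] {L' : Set α} (hLE : L' ⊆ N.E)
    (hnl : ∀ e ∈ L', N.IsNonloop e)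
    (hnt : ∀ p ∈ L', ∀ q ∈ L', ∀ r ∈ L', p ≠ q → p ≠ r → q ≠ r → q ∈ N.closure {p} → r ∉ N.closure {p})
    (hL2 : N.eRk L' ≤ 2) (hL5 : 5 ≤ L'.ncard) {ℓ ℓ' : α} (hℓ : ℓ ∈ L') (hℓ' : ℓ' ∈ L') (hne : ℓ ≠ ℓ') :
    ℓ ∈ N.closure (L' \ {ℓ, ℓ'}) ∧ ℓ' ∈ N.closure (L' \ {ℓ, ℓ'}) := by
  have hsub : L' \ {ℓ, ℓ'} ⊆ L' := Set.sdiff_subset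
  -- `ℓ' ∈ cl (L' ∖ {ℓ'})`, and `L' ∖ {ℓ'}` is a rank-`≤ 2` set with `≥ 4` elements containing `ℓ`
  have hfin : L'.Finite := N.ground_finite.subset hLE
  have hL'1 : ℓ' ∈ N.closure ((L' \ {ℓ}) \ {ℓ'}) := by
    refine mem_closure_sdiff_of_eRk_le_two (Set.sdiff_subset.trans hLE) (fun e he => hnl e he.1)
      (fun p hp q hq r hr => hnt p hp.1 q hq.1 r hr.1) ((N.eRk_mono Set.sdiff_subset).trans hL2) ?_
      ⟨hℓ', fun h => hne (by rw [Set.mem_singleton_iff] at h; exact h.symm)⟩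
    rw [Set.ncard_sdiff_singleton_of_mem hℓ]; omega
  have hL1 : ℓ ∈ N.closure ((L' \ {ℓ'}) \ {ℓ}) := by
    refine mem_closure_sdiff_of_eRk_le_two (Set.sdiff_subset.trans hLE) (fun e he => hnl e he.1)
      (fun p hp q hq r hr => hnt p hp.1 q hq.1 r hr.1) ((N.eRk_mono Set.sdiff_subset).trans hL2) ?_
      ⟨hℓ, fun h => hne (by rw [Set.mem_singleton_iff] at h; exact h)⟩
    rw [Set.ncard_sdiff_singleton_of_mem hℓ']; omega
  have e1 : (L' \ {ℓ}) \ {ℓ'} = L' \ {ℓ, ℓ'} := by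
    ext x; simp only [Set.mem_sdiff, Set.mem_singleton_iff, Set.mem_insert_iff]; tauto
  have e2 : (L' \ {ℓ'}) \ {ℓ} = L' \ {ℓ, ℓ'} := by
    ext x; simp only [Set.mem_sdiff, Set.mem_singleton_iff, Set.mem_insert_iff]; tauto
  rw [e1] at hL'1; rw [e2] at hL1
  exact ⟨hL1, hL'1⟩

/-! ## The type-B target -/

/-- **A base minus one element plus a point off the hyperplane it spans is a base again** (rank `5`). -/
lemma isBase_insert_sdiff_of_notMem_closure {N : Matroid α} [N.Finite] {W : Set α} (hW : N.IsBase W) {b x : α}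
    (hb : b ∈ W) (hxE : x ∈ N.E) (hxW : x ∉ W) (hx : x ∉ N.closure (W \ {b})) :
    N.IsBase (insert x (W \ {b})) := by
  have hI : N.Indep (W \ {b}) := hW.indep.subset Set.sdiff_subset
  have hxW' : x ∉ W \ {b} := fun h => hxW h.1
  have hI' : N.Indep (insert x (W \ {b})) := (hI.insert_indep_iff_of_notMem hxW').mpr ⟨hxE, hx⟩
  have hWfin : W.Finite := N.ground_finite.subset hW.subset_ground
  refine hI'.isBase_of_eRk_ge (hWfin.sdiff.insert x) ?_
  rw [hI'.eRk_eq_encard, Set.encard_insert_of_notMem hxW', Set.encard_sdiff_singleton_add_one hb,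
    hW.encard_eq_eRank]

/-- **THE TYPE-B TARGET IS VALID** (night-1 g41, §53): `N` of rank `5`, loopless, without a parallel triple; `W` a base
through `b` whose complement is `C ⊔ L'` with `L'` of rank `≤ 2` and `≥ 4` elements; `ℓ ∈ L'`, `c ∈ C` with
`{ℓ, c} ⊄ cl (W ∖ b)` and `L' ∪ (C ∖ c) ∪ {b}` spanning. Then `Z := (W ∖ b) ∪ {ℓ, c}` spans, `E ∖ Z` spans, and
every `t ∈ C ∖ c` is a coloop of `N|(E ∖ Z)` provided `C` has three elements. -/
theorem typeB_target_valid {N : Matroid α} [N.Finite] (h5 : N.eRank = 5)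
    (hnl : ∀ e ∈ N.E, N.IsNonloop e)
    (hnt : ∀ p ∈ N.E, ∀ q ∈ N.E, ∀ r ∈ N.E, p ≠ q → p ≠ r → q ≠ r → q ∈ N.closure {p} → r ∉ N.closure {p})
    {W : Set α} (hW : N.IsBase W) {b : α} (hb : b ∈ W)
    {C L' : Set α} (hY : N.E \ W = C ∪ L') (hdj : Disjoint C L') (hL2 : N.eRk L' ≤ 2) (hL4 : 4 ≤ L'.ncard)
    (hC3 : C.ncard = 3) {ℓ c : α} (hℓ : ℓ ∈ L') (hc : c ∈ C) (hZ : ¬ ({ℓ, c} ⊆ N.closure (W \ {b})))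
    (hval : N.Spanning (L' ∪ (C \ {c}) ∪ {b})) :
    N.Spanning ((W \ {b}) ∪ {ℓ, c}) ∧ N.Spanning (N.E \ ((W \ {b}) ∪ {ℓ, c})) ∧
      ∀ t ∈ C \ {c}, ¬ N.Spanning ((N.E \ ((W \ {b}) ∪ {ℓ, c})) \ {t}) := by
  classical
  have hWE : W ⊆ N.E := hW.subset_ground
  have hCE : C ⊆ N.E := fun x hx => (hY ▸ (Set.mem_union_left L' hx) : x ∈ N.E \ W).1
  have hLE : L' ⊆ N.E := fun x hx => (hY ▸ (Set.mem_union_right C hx) : x ∈ N.E \ W).1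
  have hCW : ∀ x ∈ C, x ∉ W := fun x hx => (hY ▸ (Set.mem_union_left L' hx) : x ∈ N.E \ W).2
  have hLW : ∀ x ∈ L', x ∉ W := fun x hx => (hY ▸ (Set.mem_union_right C hx) : x ∈ N.E \ W).2
  have hℓE : ℓ ∈ N.E := hLE hℓ
  have hcE : c ∈ N.E := hCE hc
  have hℓW : ℓ ∉ W := hLW ℓ hℓ
  have hcW : c ∉ W := hCW c hc
  have hℓc : ℓ ≠ c := fun h => hdj.notMem_of_mem_right hℓ (h ▸ hc)
  have hbℓ : b ≠ ℓ := fun h => hℓW (h ▸ hb)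
  have hbc : b ≠ c := fun h => hcW (h ▸ hb)
  set Z := (W \ {b}) ∪ {ℓ, c} with hZdef
  have hZE : Z ⊆ N.E := by
    intro x hx
    rcases hx with hx | hx
    · exact hWE hx.1
    · rcases hx with rfl | rfl
      · exact hℓE
      · exact hcE
  -- (1) `Z` spans
  have hZsp : N.Spanning Z := by
    obtain ⟨x, hxℓc, hx⟩ := Set.not_subset.mp hZ
    have hxE : x ∈ N.E := by
      rcases hxℓc with rfl | rfl
      · exact hℓE
      · exact hcE
    have hxW : x ∉ W := by
      rcases hxℓc with rfl | rfl
      · exact hℓW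
      · exact hcW
    have hB := isBase_insert_sdiff_of_notMem_closure hW hb hxE hxW hx
    refine hB.spanning.superset ?_ hZE
    intro y hy
    rcases hy with rfl | hy
    · exact Set.mem_union_right _ hxℓc
    · exact Set.mem_union_left _ hy
  -- the complement of `Z` contains `(L' ∖ ℓ) ∪ (C ∖ c) ∪ {b}`
  have hcompl : (L' \ {ℓ}) ∪ (C \ {c}) ∪ {b} ⊆ N.E \ Z := by
    intro x hx
    rcases hx with (hx | hx) | hx
    · refine ⟨hLE hx.1, ?_⟩
      rintro (hxW | hxℓc)
      · exact hLW x hx.1 hxW.1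
      · rcases hxℓc with rfl | rfl
        · exact hx.2 rfl
        · exact hdj.notMem_of_mem_right hx.1 hc
    · refine ⟨hCE hx.1, ?_⟩
      rintro (hxW | hxℓc)
      · exact hCW x hx.1 hxW.1
      · rcases hxℓc with rfl | rfl
        · exact hdj.notMem_of_mem_left hx.1 hℓ
        · exact hx.2 rfl
    · rw [Set.mem_singleton_iff] at hx
      subst hx
      refine ⟨hWE hb, ?_⟩
      rintro (hxW | hxℓc)
      · exact hxW.2 rfl
      · rcases hxℓc with h | h
        · exact hbℓ h
        · exact hbc h
  -- (2) `E ∖ Z` spans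
  have hℓcl : ℓ ∈ N.closure (L' \ {ℓ}) :=
    mem_closure_sdiff_of_eRk_le_two hLE (fun e he => hnl e (hLE he))
      (fun p hp q hq r hr => hnt p (hLE hp) q (hLE hq) r (hLE hr)) hL2 hL4 hℓ
  have hEZsp : N.Spanning (N.E \ Z) := by
    rw [Matroid.spanning_iff_ground_subset_closure Set.sdiff_subset]
    have h1 : L' ∪ (C \ {c}) ∪ {b} ⊆ N.closure (N.E \ Z) := by
      intro x hx
      rcases hx with (hx | hx) | hx
      · by_cases hxℓ : x = ℓ
        · subst hxℓ
          exact N.closure_subset_closure (Set.subset_union_left.trans (Set.subset_union_left.trans hcompl)) hℓcl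
        · exact N.subset_closure _ Set.sdiff_subset
            (hcompl (Set.mem_union_left _ (Set.mem_union_left _ ⟨hx, hxℓ⟩)))
      · exact N.subset_closure _ Set.sdiff_subset (hcompl (Set.mem_union_left _ (Set.mem_union_right _ hx)))
      · exact N.subset_closure _ Set.sdiff_subset (hcompl (Set.mem_union_right _ hx))
    have h2 : N.closure (L' ∪ (C \ {c}) ∪ {b}) ⊆ N.closure (N.E \ Z) :=
      N.closure_subset_closure_of_subset_closure h1
    rw [hval.closure_eq] at h2
    exact h2
  -- (3) the coloops
  refine ⟨hZsp, hEZsp, ?_⟩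
  intro t ht hsp
  have htC : t ∈ C := ht.1
  have htc : t ≠ c := fun h => ht.2 (by rw [Set.mem_singleton_iff]; exact h)
  -- `(E ∖ Z) ∖ t ⊆ L' ∪ (C ∖ {c, t}) ∪ {b}`
  have hsub : (N.E \ Z) \ {t} ⊆ L' ∪ (C \ {c, t}) ∪ {b} := by
    intro x hx
    obtain ⟨⟨hxE, hxZ⟩, hxt⟩ := hx
    rw [Set.mem_singleton_iff] at hxt
    by_cases hxb : x = b
    · exact Set.mem_union_right _ (by rw [Set.mem_singleton_iff]; exact hxb)
    · have hxW : x ∉ W := fun h => hxZ (Set.mem_union_left _ ⟨h, hxb⟩)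
      have hxY : x ∈ C ∪ L' := hY ▸ ⟨hxE, hxW⟩
      rcases hxY with hxC | hxL
      · have hxc : x ≠ c := fun h => hxZ (Set.mem_union_right _ (by rw [h]; exact Set.mem_insert_of_mem _ rfl))
        exact Set.mem_union_left _ (Set.mem_union_right _ ⟨hxC, by
          simp only [Set.mem_insert_iff, Set.mem_singleton_iff, not_or]; exact ⟨hxc, hxt⟩⟩)
      · exact Set.mem_union_left _ (Set.mem_union_left _ hxL)
  -- `C ∖ {c, t}` has one element
  have hCfin : C.Finite := N.ground_finite.subset hCE
  have hC1 : (C \ {c, t}).ncard = 1 := by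
    have : C \ {c, t} = (C \ {c}) \ {t} := by
      ext x; simp only [Set.mem_sdiff, Set.mem_insert_iff, Set.mem_singleton_iff]; tauto
    rw [this, Set.ncard_sdiff_singleton_of_mem ht, Set.ncard_sdiff_singleton_of_mem hc, hC3]
  -- the rank of the right-hand side is at most `4`
  have hrk : N.eRk (L' ∪ (C \ {c, t}) ∪ {b}) ≤ 4 := by
    have hCfin' : (C \ {c, t}).Finite := hCfin.subset Set.sdiff_subset
    have hC1' : (C \ {c, t}).encard = 1 := by
      rw [hCfin'.encard_eq_coe_toFinset_card, ← Set.ncard_eq_toFinset_card _ hCfin', hC1]; rfl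
    calc N.eRk (L' ∪ (C \ {c, t}) ∪ {b}) ≤ N.eRk (L' ∪ (C \ {c, t})) + N.eRk {b} := N.eRk_union_le_eRk_add_eRk _ _
      _ ≤ (N.eRk L' + N.eRk (C \ {c, t})) + N.eRk {b} := by gcongr; exact N.eRk_union_le_eRk_add_eRk _ _
      _ ≤ (2 + 1) + 1 := by
          gcongr
          · exact (N.eRk_le_encard _).trans (by rw [hC1'])
          · exact N.eRk_singleton_le b
      _ = 4 := by norm_num
  have h5' : N.eRk ((N.E \ Z) \ {t}) = 5 := by rw [hsp.eRk_eq, h5]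
  have h54 : (5 : ℕ∞) ≤ 4 := by
    calc (5 : ℕ∞) = N.eRk ((N.E \ Z) \ {t}) := h5'.symm
      _ ≤ N.eRk (L' ∪ (C \ {c, t}) ∪ {b}) := N.eRk_mono hsub
      _ ≤ 4 := hrk
  have h54' : (5 : ℕ) ≤ 4 := by exact_mod_cast h54
  omega

end PercRepro
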